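import Summits.ValiantsHypothesis.ValiantsHypothesis.Theorems.MonotoneRestorationOrbitRestorationQPValueTermsAction
import Summits.ValiantsHypothesis.ValiantsHypothesis.Theorems.MonotoneRestorationOrbitRestorationQPTermCircuitOrbit
import HarnessLib

/-!
# The value-orbit symmetrisation theorem (symmetrisation in ORBIT currency, IV)

Route MonotoneRestoration, crux `OrbitRestorationQP` (stmt-ValiantsHypothesis-18293), namespace
`Summit.ValiantsHypothesis.ValiantsHypothesis.Theorems.ValueDerivation`.

**Theorem** (`exists_symmetric_of_valueDerivation`).  Let a finite group `Γ` act on the finitely many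
variables `X`, let `K` be a field of characteristic `0`, and let `f ∈ K[X]` be `Γ`-invariant.  If `f` is a
value of a value derivation `𝒟` (`…ValueDerivation.lean`: an ordinary straight-line computation of ANY
length — weighted sums of any fan-in, binary products) all of whose values `q` have `|Γ • q| ≤ B` (and
`|Γ • x| ≤ B` for the variables), then `f` is computed by a `Γ`-symmetric Dawar–Wilsenach circuit whose
orbit size `ORB` — the largest orbit of a gate under ALL automorphisms (§3.3) — is at most `B²`.

So symmetry is free in orbit currency: the symmetric orbit complexity of an invariant polynomial is, up to
squaring, the least `B` such that SOME computation of it (of any length) passes only through values with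
`Γ`-orbits `≤ B`.  The circuit is the reduced term circuit (K3 engine `TermCircuit.exists_symmetric_orbitSize_le`,
`…TermCircuitOrbit.lean`) of the universe of canonical terms `tm q`, `q ∈ U = Γ • S`
(`…ValueTerms.lean`): `q ↦ tm q` is equivariant (`act_tm`), so the orbit of the TERM `tm q` is the orbit
of the VALUE `q` (`≤ B`); the only other internal terms are the scaled summands `c · tm v` (orbit `≤ B`),
the averaging nodes (orbit `≤ B`) and the binary product nodes `tm a · tm b` (orbit `≤ |Γ • (a, b)| ≤ B²`).

* `univ` — the universe; `univ_stable`, `ncard_orbit_term_le`;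
* `exists_symmetric_of_valueDerivation` — the theorem.

Everything is proved. [folklore]

## References
* A. Dawar, G. Wilsenach, *Symmetric arithmetic circuits*, ToC 21 (2025), Defs. 2.2, 3.6, 3.7, §3.3
  (`Orb`, `ORB`, rigid). [DawarWilsenach2025]
* A. Dawar, B. Pago, T. Seppelt, *Symmetric algebraic circuits and homomorphism polynomials*,
  arXiv:2502.06740 (2025), §5 (rigidification; one gate per tuple). [DawarPagoSeppelt2025]
-/

noncomputable section

open scoped Classical

-- `Summit.ValiantsHypothesis.ValiantsHypothesis.…` is the tree's single-conjunct layout (Sub = Summit).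
set_option linter.dupNamespace false

namespace Summit.ValiantsHypothesis.ValiantsHypothesis.Theorems

open HTerm

universe u v w

namespace ValueDerivation

open Literature.Computability.AlgebraicComplexity

variable {K : Type u} {X : Type v} [Field K] (𝒟 : ValueDerivation K X)
variable {Γ : Type w} [Group Γ] [Fintype Γ] [MulAction Γ X]

/-! ### The universe of canonical terms -/

/-- The coefficients of the chosen sum-steps. [folklore] -/
def coefs : Finset K :=
  𝒟.S.biUnion fun p => match 𝒟.stepOf p with
    | StepData.sum D => (D.map Prod.fst).toFinset
    | _ => ∅

/-- The constants of the chosen constant-steps. [folklore] -/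
def stepConsts : Finset K :=
  𝒟.S.biUnion fun p => match 𝒟.stepOf p with
    | StepData.const c => {c}
    | _ => ∅

variable (Γ) in
/-- All constants used: `0`, the averaging weights `N_q⁻¹`, the coefficients, the step constants.
[folklore] -/
def allConsts : Finset K :=
  insert 0 ((𝒟.U Γ).image fun q => (((𝒟.W Γ q).card : K)⁻¹)) ∪ 𝒟.coefs ∪ 𝒟.stepConsts

variable (Γ) in
/-- The scaled-summand nodes `c · tm v`. [folklore] -/
def mNode (cv : K × MvPolynomial X K) : HTerm K X := mkNode true {HTerm.const cv.1, 𝒟.tm Γ cv.2}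

variable (Γ) in
/-- The product nodes `tm a · tm b`. [folklore] -/
def pNode (ab : MvPolynomial X K × MvPolynomial X K) : HTerm K X := mkNode true {𝒟.tm Γ ab.1, 𝒟.tm Γ ab.2}

variable (Γ) in
/-- The terms of the universe: canonical terms and averaging nodes of the values of `U`, all scaled
summands `c · tm v` (`c` a coefficient, `v ∈ U`), all product nodes `tm a · tm b` (`a, b ∈ U`), all
variable leaves and the constant leaves. [folklore] -/
def terms [Fintype X] : Finset (HTerm K X) :=
  ((𝒟.U Γ).biUnion fun q => {𝒟.tm Γ q, 𝒟.sNode Γ q}) ∪ (𝒟.coefs ×ˢ 𝒟.U Γ).image (𝒟.mNode Γ) ∪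
    ((𝒟.U Γ) ×ˢ (𝒟.U Γ)).image (𝒟.pNode Γ) ∪ Finset.univ.image (fun x : X => HTerm.var x) ∪
    (𝒟.allConsts Γ).image HTerm.const

variable [Fintype X]

/-- Membership in `terms`, unfolded. [folklore] -/
theorem mem_terms {s : HTerm K X} : s ∈ 𝒟.terms Γ ↔
    (∃ q ∈ 𝒟.U Γ, s = 𝒟.tm Γ q ∨ s = 𝒟.sNode Γ q) ∨ (∃ c ∈ 𝒟.coefs, ∃ v ∈ 𝒟.U Γ, s = 𝒟.mNode Γ (c, v)) ∨
      (∃ a ∈ 𝒟.U Γ, ∃ b ∈ 𝒟.U Γ, s = 𝒟.pNode Γ (a, b)) ∨ (∃ x : X, s = HTerm.var x) ∨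
      (∃ c ∈ 𝒟.allConsts Γ, s = HTerm.const c) := by
  simp only [terms, Finset.mem_union, Finset.mem_biUnion, Finset.mem_insert, Finset.mem_singleton,
    Finset.mem_image, Finset.mem_product, Finset.mem_univ, true_and, Prod.exists, or_assoc]
  constructor
  · rintro (⟨q, hq, h⟩ | ⟨c, v, ⟨hc, hv⟩, h⟩ | ⟨a, b, ⟨ha, hb⟩, h⟩ | ⟨x, h⟩ | ⟨c, hc, h⟩)
    · exact Or.inl ⟨q, hq, h⟩
    · exact Or.inr (Or.inl ⟨c, hc, v, hv, h.symm⟩)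
    · exact Or.inr (Or.inr (Or.inl ⟨a, ha, b, hb, h.symm⟩))
    · exact Or.inr (Or.inr (Or.inr (Or.inl ⟨x, h.symm⟩)))
    · exact Or.inr (Or.inr (Or.inr (Or.inr ⟨c, hc, h.symm⟩)))
  · rintro (⟨q, hq, h⟩ | ⟨c, hc, v, hv, h⟩ | ⟨a, ha, b, hb, h⟩ | ⟨x, h⟩ | ⟨c, hc, h⟩)
    · exact Or.inl ⟨q, hq, h⟩
    · exact Or.inr (Or.inl ⟨c, v, ⟨hc, hv⟩, h.symm⟩)
    · exact Or.inr (Or.inr (Or.inl ⟨a, b, ⟨ha, hb⟩, h.symm⟩))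
    · exact Or.inr (Or.inr (Or.inr (Or.inl ⟨x, h.symm⟩)))
    · exact Or.inr (Or.inr (Or.inr (Or.inr ⟨c, hc, h.symm⟩)))

/-- `tm q ∈ terms` for `q ∈ U`. [folklore] -/
theorem tm_mem_terms {q : MvPolynomial X K} (hq : q ∈ 𝒟.U Γ) : 𝒟.tm Γ q ∈ 𝒟.terms Γ :=
  𝒟.mem_terms.2 (Or.inl ⟨q, hq, Or.inl rfl⟩)

/-- `sNode q ∈ terms` for `q ∈ U`. [folklore] -/
theorem sNode_mem_terms {q : MvPolynomial X K} (hq : q ∈ 𝒟.U Γ) : 𝒟.sNode Γ q ∈ 𝒟.terms Γ :=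
  𝒟.mem_terms.2 (Or.inl ⟨q, hq, Or.inr rfl⟩)

/-- Constant leaves of `allConsts` are terms. [folklore] -/
theorem const_mem_terms {c : K} (hc : c ∈ 𝒟.allConsts Γ) : HTerm.const c ∈ 𝒟.terms Γ :=
  𝒟.mem_terms.2 (Or.inr (Or.inr (Or.inr (Or.inr ⟨c, hc, rfl⟩))))

/-- The members of a contribution of a least witness are terms. [folklore] -/
theorem mem_terms_of_mem_contrib {q : MvPolynomial X K} {w : Γ × MvPolynomial X K} (hw : w ∈ 𝒟.W Γ q)
    {s : HTerm K X} (hs : s ∈ contrib (𝒟.tm Γ) ((𝒟.stepOf w.2).map w.1)) : s ∈ 𝒟.terms Γ := by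
  have hp : w.2 ∈ 𝒟.S := (𝒟.mem_W.1 hw).1
  have hargs := fun u hu => 𝒟.args_step_W hw (u := u) hu
  revert hs hargs
  rcases hd : 𝒟.stepOf w.2 with x | c | D | ⟨u, v⟩ <;> intro hs hargs
  · simp only [StepData.map, contrib, Multiset.mem_singleton] at hs
    exact 𝒟.mem_terms.2 (Or.inr (Or.inr (Or.inr (Or.inl ⟨_, hs⟩))))
  · simp only [StepData.map, contrib, Multiset.mem_singleton] at hs
    rw [hs]
    refine 𝒟.const_mem_terms (Finset.mem_union_right _ (Finset.mem_biUnion.2 ⟨w.2, hp, ?_⟩))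
    simp [hd]
  · simp only [StepData.map, contrib, Multiset.mem_map, Multiset.map_map, Function.comp_def] at hs
    obtain ⟨cu, hcu, rfl⟩ := hs
    refine 𝒟.mem_terms.2 (Or.inr (Or.inl ⟨cu.1, ?_, ren w.1 cu.2, ?_, rfl⟩))
    · refine Finset.mem_biUnion.2 ⟨w.2, hp, ?_⟩
      simp only [hd, Multiset.mem_toFinset, Multiset.mem_map]
      exact ⟨cu, hcu, rfl⟩
    · exact (hargs (ren w.1 cu.2) (by
        simp only [StepData.map, StepData.args, Multiset.map_map, Function.comp_def, Multiset.mem_map]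
        exact ⟨cu, hcu, rfl⟩)).1
  · simp only [StepData.map, contrib, Multiset.mem_singleton] at hs
    refine 𝒟.mem_terms.2 (Or.inr (Or.inr (Or.inl ⟨ren w.1 u, ?_, ren w.1 v, ?_, hs⟩)))
    · exact (hargs _ (by simp [StepData.map, StepData.args])).1
    · exact (hargs _ (by simp [StepData.map, StepData.args])).1

/-- The summands of the averaging node of `q ∈ U` are terms. [folklore] -/
theorem mem_terms_of_mem_summands {q : MvPolynomial X K} {s : HTerm K X}
    (hs : s ∈ 𝒟.summands Γ (𝒟.tm Γ) q) : s ∈ 𝒟.terms Γ := by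
  simp only [summands, Multiset.mem_add, Multiset.mem_singleton] at hs
  rcases hs with rfl | hs
  · exact 𝒟.const_mem_terms (by simp [allConsts])
  · obtain ⟨w, hw, hs⟩ := Multiset.mem_sum.1 hs
    exact 𝒟.mem_terms_of_mem_contrib hw hs

omit [Field K] [Fintype X] in
/-- Node injectivity for `mkNode`: equal nodes have equal labels and children multisets. [folklore] -/
theorem eq_of_mkNode_eq_node {b b' : Bool} {M : Multiset (HTerm K X)} {l : List (HTerm K X)}
    (h : mkNode b M = HTerm.node b' l) : b = b' ∧ (l : Multiset (HTerm K X)) = M := by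
  simp only [mkNode, HTerm.node.injEq] at h
  exact ⟨h.1, h.2 ▸ coe_tsort_toList M⟩

/-- The maximal multiplicity in the children list of a node (`0` for leaves). [folklore] -/
def maxCount : HTerm K X → ℕ
  | HTerm.node _ l => l.toFinset.sup fun u => l.count u
  | _ => 0

omit [Field K] [Fintype X] in
/-- A count in the children list is at most `maxCount`. [folklore] -/
theorem count_le_maxCount (b : Bool) (l : List (HTerm K X)) (u : HTerm K X) :
    l.count u ≤ maxCount (HTerm.node b l) := by
  by_cases hu : u ∈ l
  · exact Finset.le_sup (f := fun u => l.count u) (List.mem_toFinset.2 hu)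
  · rw [List.count_eq_zero_of_not_mem hu]; exact Nat.zero_le _

variable {f : MvPolynomial X K} (hf : f ∈ 𝒟.S)

variable (Γ) in
/-- **The universe of canonical terms** of a value derivation, rooted at the term of `f ∈ S`. [folklore] -/
def univ : TermCircuit.Universe K X where
  T := 𝒟.terms Γ
  M := (𝒟.terms Γ).sup maxCount + 1
  root := 𝒟.tm Γ f
  normal := by
    intro t ht
    rcases 𝒟.mem_terms.1 ht with ⟨q, -, rfl | rfl⟩ | ⟨c, -, v, -, rfl⟩ | ⟨a, -, b, -, rfl⟩ | ⟨x, rfl⟩ |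
      ⟨c, -, rfl⟩
    · exact 𝒟.normalize_tm q
    · exact normalize_mkNode false fun s hs => by
        simp only [summands, Multiset.mem_add, Multiset.mem_singleton] at hs
        rcases hs with rfl | hs
        · simp
        · obtain ⟨w, _, hw⟩ := Multiset.mem_sum.1 hs
          exact normalize_of_mem_contrib 𝒟.normalize_tm _ hw
    · exact normalize_mkNode true (by simp [𝒟.normalize_tm])
    · exact normalize_mkNode true (by simp [𝒟.normalize_tm])
    · simp
    · simp
  closed := by
    intro b l hl u hu
    rcases 𝒟.mem_terms.1 hl with ⟨q, hq, h | h⟩ | ⟨c, hc, v, hv, h⟩ | ⟨a, ha, b', hb, h⟩ | ⟨x, h⟩ |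
      ⟨c, -, h⟩
    · rw [𝒟.tm_eq q] at h
      obtain ⟨-, hM⟩ := eq_of_mkNode_eq_node h.symm
      have hu' : u ∈ (l : Multiset (HTerm K X)) := hu
      rw [hM] at hu'
      simp only [Multiset.insert_eq_cons, Multiset.mem_cons, Multiset.mem_singleton] at hu'
      rcases hu' with rfl | rfl
      · exact 𝒟.const_mem_terms (by simp [allConsts, Finset.mem_image]; exact Or.inr (Or.inl ⟨q, hq, rfl⟩))
      · exact 𝒟.sNode_mem_terms hq
    · obtain ⟨-, hM⟩ := eq_of_mkNode_eq_node h.symm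
      have hu' : u ∈ (l : Multiset (HTerm K X)) := hu
      rw [hM] at hu'
      exact 𝒟.mem_terms_of_mem_summands hu'
    · obtain ⟨-, hM⟩ := eq_of_mkNode_eq_node h.symm
      have hu' : u ∈ (l : Multiset (HTerm K X)) := hu
      rw [hM] at hu'
      simp only [Multiset.insert_eq_cons, Multiset.mem_cons, Multiset.mem_singleton] at hu'
      rcases hu' with rfl | rfl
      · exact 𝒟.const_mem_terms (by simp [allConsts, hc])
      · exact 𝒟.tm_mem_terms hv
    · obtain ⟨-, hM⟩ := eq_of_mkNode_eq_node h.symm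
      have hu' : u ∈ (l : Multiset (HTerm K X)) := hu
      rw [hM] at hu'
      simp only [Multiset.insert_eq_cons, Multiset.mem_cons, Multiset.mem_singleton] at hu'
      rcases hu' with rfl | rfl
      · exact 𝒟.tm_mem_terms ha
      · exact 𝒟.tm_mem_terms hb
    · cases h
    · cases h
  binary := by
    intro l hl
    rcases 𝒟.mem_terms.1 hl with ⟨q, -, h | h⟩ | ⟨c, -, v, -, h⟩ | ⟨a, -, b', -, h⟩ | ⟨x, h⟩ | ⟨c, -, h⟩
    · rw [𝒟.tm_eq q] at h
      obtain ⟨-, hM⟩ := eq_of_mkNode_eq_node h.symm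
      rw [← Multiset.coe_card, hM]; simp
    · exact absurd (eq_of_mkNode_eq_node h.symm).1 (by simp)
    · obtain ⟨-, hM⟩ := eq_of_mkNode_eq_node h.symm
      rw [← Multiset.coe_card, hM]; simp
    · obtain ⟨-, hM⟩ := eq_of_mkNode_eq_node h.symm
      rw [← Multiset.coe_card, hM]; simp
    · cases h
    · cases h
  nonempty := by
    intro l hl
    rcases 𝒟.mem_terms.1 hl with ⟨q, -, h | h⟩ | ⟨c, -, v, -, h⟩ | ⟨a, -, b', -, h⟩ | ⟨x, h⟩ | ⟨c, -, h⟩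
    · rw [𝒟.tm_eq q] at h
      exact absurd (eq_of_mkNode_eq_node h.symm).1 (by simp)
    · obtain ⟨-, hM⟩ := eq_of_mkNode_eq_node h.symm
      intro hnil
      subst hnil
      have : (HTerm.const 0 : HTerm K X) ∈ ((([] : List (HTerm K X))) : Multiset (HTerm K X)) := by
        rw [hM]; simp [summands]
      simp at this
    · exact absurd (eq_of_mkNode_eq_node h.symm).1 (by simp)
    · exact absurd (eq_of_mkNode_eq_node h.symm).1 (by simp)
    · cases h
    · cases h
  count_le := by
    intro l hl u
    exact (count_le_maxCount false l u).trans ((Finset.le_sup (f := maxCount) hl).trans (Nat.le_succ _))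
  one_le := Nat.le_add_left 1 _
  root_mem := 𝒟.tm_mem_terms (𝒟.mem_U_of_mem_S hf)
  root_node := by
    rw [𝒟.tm_eq f]
    exact ⟨true, _, rfl⟩

/-- The universe is `Γ`-stable. [folklore] -/
theorem univ_stable : ∀ (δ : Γ) (t : HTerm K X), t ∈ (𝒟.univ Γ hf).T → act δ t ∈ (𝒟.univ Γ hf).T := by
  intro δ t ht
  change t ∈ 𝒟.terms Γ at ht
  change act δ t ∈ 𝒟.terms Γ
  rcases 𝒟.mem_terms.1 ht with ⟨q, hq, rfl | rfl⟩ | ⟨c, hc, v, hv, rfl⟩ | ⟨a, ha, b, hb, rfl⟩ | ⟨x, rfl⟩ |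
    ⟨c, hc, rfl⟩
  · rw [𝒟.act_tm δ hq]; exact 𝒟.tm_mem_terms (𝒟.ren_mem_U δ hq)
  · rw [𝒟.act_sNode δ q]; exact 𝒟.sNode_mem_terms (𝒟.ren_mem_U δ hq)
  · refine 𝒟.mem_terms.2 (Or.inr (Or.inl ⟨c, hc, ren δ v, 𝒟.ren_mem_U δ hv, ?_⟩))
    rw [mNode, act_mkNode, mNode]
    simp [𝒟.act_tm δ hv]
  · refine 𝒟.mem_terms.2 (Or.inr (Or.inr (Or.inl ⟨ren δ a, 𝒟.ren_mem_U δ ha, ren δ b, 𝒟.ren_mem_U δ hb, ?_⟩)))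
    rw [pNode, act_mkNode, pNode]
    simp [𝒟.act_tm δ ha, 𝒟.act_tm δ hb]
  · exact 𝒟.mem_terms.2 (Or.inr (Or.inr (Or.inr (Or.inl ⟨δ • x, act_var δ x⟩))))
  · exact 𝒟.mem_terms.2 (Or.inr (Or.inr (Or.inr (Or.inr ⟨c, hc, act_const δ c⟩))))

/-- **Orbits of member terms**: at most `B · B`, when the values of `S` and the variables have orbits
`≤ B`. [folklore] -/
theorem ncard_orbit_term_le {B : ℕ} (hB : 1 ≤ B) (hX : ∀ x : X, (Set.range fun δ : Γ => δ • x).ncard ≤ B)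
    (hS : ∀ p ∈ 𝒟.S, (Set.range fun δ : Γ => ren δ p).ncard ≤ B) {t : HTerm K X}
    (ht : t ∈ (𝒟.univ Γ hf).T) : (Set.range fun δ : Γ => act δ t).ncard ≤ B * B := by
  have hBB : B ≤ B * B := by nlinarith
  change t ∈ 𝒟.terms Γ at ht
  rcases 𝒟.mem_terms.1 ht with ⟨q, hq, rfl | rfl⟩ | ⟨c, hc, v, hv, rfl⟩ | ⟨a, ha, b, hb, rfl⟩ | ⟨x, rfl⟩ |
    ⟨c, hc, rfl⟩
  · refine le_trans ?_ ((𝒟.ncard_orbit_le_of_mem_U hS hq).trans hBB)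
    exact TermCircuit.ncard_range_le_of_factor _ (fun δ : Γ => ren δ q) (𝒟.tm Γ) fun δ => 𝒟.act_tm δ hq
  · refine le_trans ?_ ((𝒟.ncard_orbit_le_of_mem_U hS hq).trans hBB)
    exact TermCircuit.ncard_range_le_of_factor _ (fun δ : Γ => ren δ q) (𝒟.sNode Γ) fun δ => 𝒟.act_sNode δ q
  · refine le_trans ?_ ((𝒟.ncard_orbit_le_of_mem_U hS hv).trans hBB)
    refine TermCircuit.ncard_range_le_of_factor _ (fun δ : Γ => ren δ v) (fun v' => 𝒟.mNode Γ (c, v'))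
      fun δ => ?_
    rw [mNode, act_mkNode, mNode]
    simp [𝒟.act_tm δ hv]
  · have hfac := TermCircuit.ncard_range_le_of_factor (fun δ : Γ => act δ (𝒟.pNode Γ (a, b)))
      (fun δ : Γ => (ren δ a, ren δ b)) (fun ab => 𝒟.pNode Γ ab) fun δ => by
        rw [pNode, act_mkNode, pNode]; simp [𝒟.act_tm δ ha, 𝒟.act_tm δ hb]
    refine hfac.trans ?_
    have hsub : (Set.range fun δ : Γ => (ren δ a, ren δ b)) ⊆
        (Set.range fun δ : Γ => ren δ a) ×ˢ (Set.range fun δ : Γ => ren δ b) := by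
      rintro _ ⟨δ, rfl⟩; exact ⟨⟨δ, rfl⟩, ⟨δ, rfl⟩⟩
    refine (Set.ncard_le_ncard hsub ((Set.finite_range _).prod (Set.finite_range _))).trans ?_
    rw [Set.ncard_prod]
    exact Nat.mul_le_mul (𝒟.ncard_orbit_le_of_mem_U hS ha) (𝒟.ncard_orbit_le_of_mem_U hS hb)
  · refine le_trans ?_ ((hX x).trans hBB)
    exact TermCircuit.ncard_range_le_of_factor _ (fun δ : Γ => δ • x) HTerm.var fun δ => act_var δ x
  · rw [show (Set.range fun δ : Γ => act δ (HTerm.const c : HTerm K X)) = {HTerm.const c} from ?_]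
    · rw [Set.ncard_singleton]; exact hB.trans hBB
    · ext s; simp only [act_const, Set.mem_range, Set.mem_singleton_iff, exists_const, eq_comm]

/-! ### The theorem -/

/-- **THE VALUE-ORBIT SYMMETRISATION THEOREM.**  Let a finite group `Γ` act on the finitely many variables
`X`, `K` a field of characteristic `0`, and let `f` be `Γ`-invariant.  If `f` is a value of a value
derivation — an ordinary straight-line computation of ANY length (weighted sums of any fan-in, binary
products) — all of whose values `q` have `Γ`-orbits `|Γ • q| ≤ B` (and `|Γ • x| ≤ B` for the variables,
`1 ≤ B`), then `f` is computed by a `Γ`-SYMMETRIC labelled arithmetic circuit (Dawar–Wilsenach Def. 3.7)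
whose orbit size `ORB` — largest orbit of a gate under ALL automorphisms extending elements of `Γ`, §3.3 —
is at most `B · B`.  Symmetry costs nothing in orbit currency: only the orbits of the intermediate VALUES
of some computation matter, not its length or shape. [folklore] -/
theorem exists_symmetric_of_valueDerivation [CharZero K] (hf : f ∈ 𝒟.S) {B : ℕ} (hB : 1 ≤ B)
    (hfix : ∀ δ : Γ, ren δ f = f) (hX : ∀ x : X, (Set.range fun δ : Γ => δ • x).ncard ≤ B)
    (hS : ∀ p ∈ 𝒟.S, (Set.range fun δ : Γ => ren δ p).ncard ≤ B) :
    ∃ (G : Type (max u v)) (_ : Fintype G) (C : LabelledArithCircuit K X Unit G),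
      C.IsSymmetric Γ ∧ C.eval (C.output ()) = f ∧ C.orbitSize Γ ≤ B * B := by
  have hroot : ∀ δ : Γ, act δ (𝒟.univ Γ hf).root = (𝒟.univ Γ hf).root := fun δ => by
    change act δ (𝒟.tm Γ f) = 𝒟.tm Γ f
    rw [𝒟.act_tm δ (𝒟.mem_U_of_mem_S hf), hfix]
  obtain ⟨G, inst, C, hC, hev, horb⟩ := TermCircuit.exists_symmetric_orbitSize_le (𝒟.univ Γ hf)
    (𝒟.univ_stable hf) hroot (B * B) (hB.trans (Nat.le_mul_of_pos_right B hB))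
    (fun x => (hX x).trans (Nat.le_mul_of_pos_right B hB)) (fun t ht => 𝒟.ncard_orbit_term_le hf hB hX hS ht)
  exact ⟨G, inst, C, hC, hev.trans (𝒟.val_tm (𝒟.mem_U_of_mem_S hf)), horb⟩

end ValueDerivation

end Summit.ValiantsHypothesis.ValiantsHypothesis.Theorems

end
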